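import Literature.MathematicalPhysics.QuantumFieldTheory.Balaban1983to89.B11Thm1ExistsUniqueInductionGBridges
import Literature.MathematicalPhysics.QuantumFieldTheory.Balaban1983to89.B15DeterminingSetsB

/-!
# `Balaban1983to89.B11Thm1ExistsUniqueTruncationData` — [Balaban1985Variational] = «[15]», Theorem 1, the induction step (11)–(13) pp. 279–280: THE DETERMINING DATA AND THE CLASS
# RANGES OF THE TRUNCATED PROBLEM `𝔅′_{k−1}` VERSUS THOSE OF THE FULL PROBLEM — print's *«Λ′_j = Λ_j for j = 0, 1, …, k − 2, Λ′_{k−1} = Λ_{k−1} ∪ B(Λ_k)»* (p. 279) for r11's (2.18) index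
# truncated by one length (`B11Thm1ExistsUniqueInductionG.truncSeq`), in BOTH datum readings — [III] (2.2)'s site-level determining set `genSet` (reading (b): the bonds MEETING `Γ_j`,
# `bondsDet (genSet …)`) and print's [II] (2.3) bond datum `B15DeterminingSetsB.lamBondsSeq` (ruling (α) of record) — plus the [6] (1.7)∕(1.9) class ranges `Sect2.omegaPlaqsTop ∕
# omegaBondsTop` and node00-def-R's selector `suppDomOfRecord` under truncation (THEOREMS ONLY)

Honest framing: statement-level skeleton of published theorems with citation tags; proofs where landed; nothing here is a claim about the Yang–Mills mass gap.  Cell `pub-ymgap`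
(HUMAN RULINGS D-0062 ∕ D-0149), lane `pub-ymgap-dag-n12-c` g34 (R134 seat (a), N12 = [B15], s1); `--kind proof --supports` K1⁹ `stmt-QuantumFields-27364`; count-neutral; N12 NOT
discharged; finite 𝕋⁴ at fixed ε; nothing continuum ∕ ℝ⁴ ∕ OS ∕ mass-gap ∕ Clay.  THEOREMS ONLY (0 `def`, 0 `instance`, 0 `sorry`): elementary set bookkeeping about r11's index, [III]
(2.2), [II] (2.3) and [6] (1.7)∕(1.9); nothing of Bałaban's analysis is touched.

WHY.  The LIFT token `VariationalThm1EULift{Top,CoP}7MG(B)` ([15] (11)–(13); `B11Thm1ExistsUniqueInductionG` ∕ `B11Thm1ExistsUniqueTokensGB`) asks a producer to turn a regular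
minimiser of the TRUNCATED problem `(truncSeq s, k)` into an approximate minimiser (14) of the full problem `(s, k+1)`.  Print's one sentence *«From the conditions (11), and from the
form (2) of the regularity conditions, it follows that U₀ ∈ U_k({Ω_j}, B₃L³ε₁) ∩ 𝔘_k(𝔅_k, V)»* (p. 280, (13)) rests on three pieces of index bookkeeping, which this file proves once, for
every index, so that a lift producer (and the lane's flat-datum A2 certificates, `Summits/…/BalabanUVNodesN12EUStepTokensAtFlatDatum` §3, where they were inlined at the (b)-datum)
can cite them by name at EITHER datum:
(T1) below the top the truncated problem's determining data CONTAIN the full problem's: `Γ′_j = Γ_j` for `j < k` and `Γ′_k = Ω_k ⊇ Ω_k ∖ Ω_{k+1} = Γ_k` (sites), hence the same for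
the bonds meeting them (reading (b)) and — with the SAME exclusion of inward connectors below `k` and NO exclusion at the truncated top — for print's bond datum (2.3): `Λ′_j = Λ_j`
(`j < k`) as bond sets and `Λ_k ⊆ Λ′_k = st(Ω_k^{(k)})`;
(T2) at and below `k` the class ranges (the plaquettes ∕ bonds MEETING `Ω_n`, or the top domain at `n = 0`) of the two problems COINCIDE, and the full problem's top ranges at `k+1` sit
INSIDE its scale-`k` ranges (`Ω_{k+1} ⊆ Ω_k`) — the home of the factor `L³` (`η_k = L·η_{k+1}`) in (13);
(T3) node00-def-R's selector `suppDomOfRecord` reads `Ω_1` only, which the truncation keeps (`0 < k`).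
The remaining piece of (13) — agreement at the NEW top level `k+1` from agreement at level `k` — is the locality of Bałaban's averaging operation plus the separation geometry of the
index (`Summits/…/BalabanUVNodesN12EUStepTokensAtFlatDatum` §2 `embIter_mem_of_blockOf_eq_endpoint`), not index bookkeeping; it is not restated here.

CONTENTS (all for `s : Seq D (k+1)` over any cube-class family `D`, most under `0 < k` = print's lengths).
* §1 sites: `gammaRegion_truncSeq_of_lt` (`Γ′_j = Γ_j`, `j < k`), `gammaRegion_truncSeq_top` (`Γ′_k = Ω_k`), `gammaRegion_succ_subset_truncSeq` (`Γ_j ⊆ Γ′_j`, `j ≤ k`); the same for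
  [III] (2.2)'s `genSet` (`genSet_truncSeq_of_lt`, `genSet_truncSeq_top`, `genSet_succ_subset_truncSeq`) and for reading (b)'s bond datum (`bondsDet_genSet_truncSeq_of_lt`,
  `bondsDet_genSet_succ_subset_truncSeq`); `genSet_succ_top` (the new top member `Γ_{k+1} = Ω_{k+1}^{(k+1)}`).
* §2 print's datum: `lamBondsSeq_truncSeq_of_lt` (`Λ′_j = Λ_j` as bond sets, `j < k`), `lamBondsSeq_truncSeq_top` (`Λ′_k = st(Ω_k^{(k)})`), `lamBondsSeq_succ_subset_truncSeq` (`Λ_j ⊆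
  Λ′_j`, `j ≤ k`), `lamBondsSeq_succ_top` (`Λ_{k+1} = st(Ω_{k+1}^{(k+1)})`).
* §3 agreement transported down the truncation: `agreeOn_below_of_truncSeq` ∕ `agreeOnB_lamBondsSeq_below_of_truncSeq` — [III] (2.10) for the truncated problem gives (2.10) for the
  full problem at every level `≤ k` (both readings).
* §4 class ranges and selector: `omegaPlaqsTop_truncSeq_of_le` ∕ `omegaBondsTop_truncSeq_of_le` (`n ≤ k`: equal), `omegaPlaqsTop_succ_subset` ∕ `omegaBondsTop_succ_subset` (the top
  ranges at `k+1` inside the scale-`k` ranges), `suppDomOfRecord_truncSeq`.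

HONEST SCOPE.  Set-theoretic bookkeeping; nothing of [15]'s analysis asserted or proved; no token inhabited; count-neutral; K0⁷ ∕ K1⁹ NOT closed; N12 NOT discharged; the Yang–Mills
mass gap (Clay) is NOT proved by any of this.

References: [15] Thm 1 p.279, (11) p.279, (12)–(14) p.280, (2) p.278; [6] = [Balaban1985RegularSpaces] (1.7)–(1.9) p.77; [II] = [Balaban1984PropagatorsII] (2.3) p.224; [III] =
[Balaban1988Convergent] (2.1) p.254, (2.2) p.255, (2.10) p.256, (2.18) p.257; [I] = [Balaban1987RG1] (0.1) p.251.
-/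

noncomputable section

namespace Literature.MathematicalPhysics.QuantumFieldTheory.Balaban1983to89.B11Thm1ExistsUniqueInductionG

open T4Continuum B15DeterminingSets B15DeterminingSetsB GaugeField Node00
open B14.Eq218Concrete (Seq)

/-! ## §1  Sites: [III] (2.2)'s members of the truncated index versus the full index -/

section Sites

variable {P : Params} {D : ℕ → Set (Set (Site P 0))} {k : ℕ}

/-- `bondsOf` is monotone (local copy; the tree's copies live in modules outside this file's imports). [cite: Balaban1987RG1, (0.1) p.251 (bookkeeping)] -/
private theorem bondsOf_mono' {j : ℕ} {S T : Set (Site P j)} (h : S ⊆ T) : bondsOf S ⊆ bondsOf T :=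
  fun _ hb => hb.imp (fun hs => h hs) (fun ht => h ht)

/-- **`Γ′_j = Γ_j` BELOW THE TRUNCATED TOP** (`j < k`): the truncated index has the same regions `Ω₁ᶜ` (`j = 0`) and `Ω_j ∖ Ω_{j+1}` (`0 < j < k`) — print's *«Λ′_j = Λ_j for j = 0, 1,
…, k − 2»* (p. 279, lengths shifted by one: print's `k` is the full length). [cite: Balaban1985Variational, (11) p.279; Balaban1988Convergent, (2.2) p.255] -/
theorem gammaRegion_truncSeq_of_lt (s : Seq D (k + 1)) {j : ℕ} (hj : j < k) : gammaRegion (truncSeq s).Ω k j = gammaRegion s.Ω (k + 1) j := by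
  rcases Nat.eq_zero_or_pos j with rfl | hj0
  · rw [gammaRegion_zero (truncSeq s).Ω hj, gammaRegion_zero s.Ω (Nat.succ_pos k), truncSeq_Ω_of_le s (Nat.succ_le_of_lt hj)]
  · rw [gammaRegion_mid (truncSeq s).Ω hj0 hj, gammaRegion_mid s.Ω hj0 (Nat.lt_succ_of_lt hj), truncSeq_Ω_of_le s hj.le,
      truncSeq_Ω_of_le s (Nat.succ_le_of_lt hj)]

/-- **`Γ′_k = Ω_k` AT THE TRUNCATED TOP** — print's *«Λ′_{k−1} = Λ_{k−1} ∪ B(Λ_k)»* read on sites: `(Ω_k ∖ Ω_{k+1}) ∪ Ω_{k+1} = Ω_k`. [cite: Balaban1985Variational, (11) p.279; Balaban1988Convergent, (2.2) p.255] -/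
theorem gammaRegion_truncSeq_top (s : Seq D (k + 1)) : gammaRegion (truncSeq s).Ω k k = s.Ω k := by
  rw [gammaRegion_self, truncSeq_Ω_of_le s le_rfl]

/-- **`Γ_j ⊆ Γ′_j` FOR EVERY `j ≤ k`** (`0 < k`): equality below `k`, and `Γ_k = Ω_k ∖ Ω_{k+1} ⊆ Ω_k = Γ′_k` at `k`. [cite: Balaban1985Variational, (11) p.279; Balaban1988Convergent, (2.2) p.255] -/
theorem gammaRegion_succ_subset_truncSeq (s : Seq D (k + 1)) (hk : 0 < k) {j : ℕ} (hj : j ≤ k) : gammaRegion s.Ω (k + 1) j ⊆ gammaRegion (truncSeq s).Ω k j := by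
  rcases hj.lt_or_eq with hlt | rfl
  · rw [gammaRegion_truncSeq_of_lt s hlt]
  · rw [gammaRegion_truncSeq_top, gammaRegion_mid s.Ω hk (lt_add_one j)]
    exact fun x hx => hx.1

/-- [III] (2.2): the members `Γ_j^{(j)}` of the truncated index and of the full index COINCIDE below `k`. [cite: Balaban1988Convergent, (2.2) p.255; Balaban1985Variational, (11) p.279] -/
theorem genSet_truncSeq_of_lt (s : Seq D (k + 1)) {j : ℕ} (hj : j < k) : genSet (truncSeq s).Ω k j = genSet s.Ω (k + 1) j := by
  show pts j (gammaRegion (truncSeq s).Ω k j) = pts j (gammaRegion s.Ω (k + 1) j)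
  rw [gammaRegion_truncSeq_of_lt s hj]

/-- [III] (2.2) at the truncated top: `Γ′_k = Ω_k^{(k)}`. [cite: Balaban1988Convergent, (2.2) p.255; Balaban1985Variational, (11) p.279] -/
theorem genSet_truncSeq_top (s : Seq D (k + 1)) : genSet (truncSeq s).Ω k k = pts k (s.Ω k) := by
  show pts k (gammaRegion (truncSeq s).Ω k k) = pts k (s.Ω k)
  rw [gammaRegion_truncSeq_top]

/-- [III] (2.2): every member of the full index at a level `j ≤ k` lies inside the corresponding member of the truncated index (`0 < k`). [cite: Balaban1988Convergent, (2.2) p.255; Balaban1985Variational, (11)–(13) pp.279–280] -/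
theorem genSet_succ_subset_truncSeq (s : Seq D (k + 1)) (hk : 0 < k) {j : ℕ} (hj : j ≤ k) : genSet s.Ω (k + 1) j ⊆ genSet (truncSeq s).Ω k j :=
  Set.preimage_mono (gammaRegion_succ_subset_truncSeq s hk hj)

/-- [III] (2.2), the NEW top member of the full index: `Γ_{k+1} = Ω_{k+1}^{(k+1)}`. [cite: Balaban1988Convergent, (2.2) p.255] -/
theorem genSet_succ_top (s : Seq D (k + 1)) : genSet s.Ω (k + 1) (k + 1) = pts (k + 1) (s.Ω (k + 1)) := by
  show pts (k + 1) (gammaRegion s.Ω (k + 1) (k + 1)) = _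
  rw [gammaRegion_self]

/-- READING (b) ([I] p. 251 «bonds which intersect Γ_j»): the bonds meeting the members coincide below `k`. [cite: Balaban1987RG1, (0.1) p.251; Balaban1988Convergent, (2.2) p.255; Balaban1985Variational, (11) p.279] -/
theorem bondsDet_genSet_truncSeq_of_lt (s : Seq D (k + 1)) {j : ℕ} (hj : j < k) : bondsDet (genSet (truncSeq s).Ω k) j = bondsDet (genSet s.Ω (k + 1)) j := by
  rw [bondsDet_apply, bondsDet_apply, genSet_truncSeq_of_lt s hj]

/-- READING (b): at every level `j ≤ k` the bonds meeting `Γ_j` (full index) are among those meeting `Γ′_j` (truncated index) (`0 < k`). [cite: Balaban1987RG1, (0.1) p.251; Balaban1988Convergent, (2.2) p.255; Balaban1985Variational, (11)–(13) pp.279–280] -/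
theorem bondsDet_genSet_succ_subset_truncSeq (s : Seq D (k + 1)) (hk : 0 < k) {j : ℕ} (hj : j ≤ k) :
    bondsDet (genSet s.Ω (k + 1)) j ⊆ bondsDet (genSet (truncSeq s).Ω k) j := by
  rw [bondsDet_apply, bondsDet_apply]
  exact bondsOf_mono' (genSet_succ_subset_truncSeq s hk hj)

end Sites

/-! ## §2  Print's [II] (2.3) bond datum under truncation -/

section Lam

variable {P : Params} {D : ℕ → Set (Set (Site P 0))} {k : ℕ}

/-- **`Λ′_j = Λ_j` AS BOND SETS BELOW THE TRUNCATED TOP** (`j < k`): same member `Γ_j`, same exclusion of the inward connectors into `Ω_{j+1}` (the truncation keeps `Ω_{j+1}`,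
`j + 1 ≤ k`). [cite: Balaban1984PropagatorsII, (2.3) p.224; Balaban1985Variational, (11) p.279] -/
theorem lamBondsSeq_truncSeq_of_lt (s : Seq D (k + 1)) {j : ℕ} (hj : j < k) : lamBondsSeq (truncSeq s).Ω k j = lamBondsSeq s.Ω (k + 1) j := by
  ext b
  rw [mem_lamBondsSeq_iff, mem_lamBondsSeq_iff, ← bondsDet_apply, bondsDet_genSet_truncSeq_of_lt s hj, bondsDet_apply,
    truncSeq_Ω_of_le s (Nat.succ_le_of_lt hj)]
  simp only [hj, Nat.lt_succ_of_lt hj, forall_true_left]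

/-- **`Λ′_k = st(Ω_k^{(k)})` AT THE TRUNCATED TOP**: no inward connector is excluded at a top level ([II] (2.3) `Λ_k = Ω_k^{(k)}` «for the sets of sites and the sets of bonds»).
[cite: Balaban1984PropagatorsII, (2.3) p.224; Balaban1985Variational, (11) p.279] -/
theorem lamBondsSeq_truncSeq_top (s : Seq D (k + 1)) : lamBondsSeq (truncSeq s).Ω k k = bondsOf (pts k (s.Ω k)) := by
  rw [lamBondsSeq_top, truncSeq_Ω_of_le s le_rfl]

/-- **`Λ_j ⊆ Λ′_j` FOR EVERY `j ≤ k`** (`0 < k`): equality below `k`; at `k` the full index's `Λ_k` (bonds meeting `(Ω_k ∖ Ω_{k+1})^{(k)}`, inward connectors into `Ω_{k+1}` excluded) lies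
inside the truncated top `st(Ω_k^{(k)})` — print's «Λ′_{k−1} = Λ_{k−1} ∪ B(Λ_k)» as bond sets. [cite: Balaban1984PropagatorsII, (2.3) p.224; Balaban1985Variational, (11)–(13) pp.279–280] -/
theorem lamBondsSeq_succ_subset_truncSeq (s : Seq D (k + 1)) (hk : 0 < k) {j : ℕ} (hj : j ≤ k) : lamBondsSeq s.Ω (k + 1) j ⊆ lamBondsSeq (truncSeq s).Ω k j := by
  rcases hj.lt_or_eq with hlt | rfl
  · rw [lamBondsSeq_truncSeq_of_lt s hlt]
  · intro b hb
    rw [lamBondsSeq_truncSeq_top]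
    exact bondsOf_mono' ((genSet_succ_subset_truncSeq s hk le_rfl).trans (genSet_truncSeq_top s).subset) hb.1

/-- The NEW top of the full index: `Λ_{k+1} = st(Ω_{k+1}^{(k+1)})` (F0a `lamBondsSeq_top`, recorded in the truncation's notation). [cite: Balaban1984PropagatorsII, (2.3) p.224] -/
theorem lamBondsSeq_succ_top (s : Seq D (k + 1)) : lamBondsSeq s.Ω (k + 1) (k + 1) = bondsOf (pts (k + 1) (s.Ω (k + 1))) :=
  lamBondsSeq_top s.Ω (k + 1)

end Lam

/-! ## §3  [III] (2.10) transported down the truncation -/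

section Agreement

variable {P : Params} {D : ℕ → Set (Set (Site P 0))} {k : ℕ} {G : Type*}

/-- **AGREEMENT FOR THE TRUNCATED PROBLEM GIVES AGREEMENT FOR THE FULL PROBLEM AT EVERY LEVEL `≤ k`, READING (b)** (`0 < k`): the lower half of [15] (13)'s
«`U₀ ∈ 𝔘_k(𝔅_k, V)`» given (11)'s «`V₀ = V on ⋃_{j<k} Λ_j`» (here with one pair of fields; the consumer inserts the data identity). [cite: Balaban1985Variational, (11)–(13) pp.279–280; Balaban1988Convergent, (2.10) p.256] -/
theorem agreeOn_below_of_truncSeq (s : Seq D (k + 1)) (hk : 0 < k) {V W : MSField P G} (h : AgreeOn (genSet (truncSeq s).Ω k) V W) {j : ℕ} (hj : j ≤ k)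
    {b : PBond P j} (hb : b ∈ bondsOf (genSet s.Ω (k + 1) j)) : V j b = W j b :=
  h j b (bondsDet_genSet_succ_subset_truncSeq s hk hj hb)

/-- **THE SAME AT PRINT's DATUM**: agreement on `Λ′_j`'s bonds for the truncated problem gives agreement on `Λ_j`'s bonds for the full problem, `j ≤ k` (`0 < k`).
[cite: Balaban1985Variational, (11)–(13) pp.279–280; Balaban1984PropagatorsII, (2.3) p.224; Balaban1988Convergent, (2.10) p.256] -/
theorem agreeOnB_lamBondsSeq_below_of_truncSeq (s : Seq D (k + 1)) (hk : 0 < k) {V W : MSField P G} (h : AgreeOnB (lamBondsSeq (truncSeq s).Ω k) V W) {j : ℕ}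
    (hj : j ≤ k) {b : PBond P j} (hb : b ∈ lamBondsSeq s.Ω (k + 1) j) : V j b = W j b :=
  h j b (lamBondsSeq_succ_subset_truncSeq s hk hj hb)

end Agreement

/-! ## §4  The [6] (1.7)∕(1.9) class ranges of the top domain and node00-def-R's selector under truncation -/

section Ranges

variable {P : Params} {D : ℕ → Set (Set (Site P 0))} {k : ℕ}

/-- **THE PLAQUETTE RANGES COINCIDE AT AND BELOW `k`** (same top domain `Ω₀`): `Sect2.omegaPlaqsTop` reads `Ω₀` at `n = 0` and `Ω_n` at `n ≥ 1`, which the truncation keeps for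
`n ≤ k`. [cite: Balaban1985RegularSpaces, (1.7) p.77; Balaban1985Variational, (2) p.278, (13) p.280] -/
theorem omegaPlaqsTop_truncSeq_of_le (s : Seq D (k + 1)) (Ω₀ : Set (Site P 0)) {n : ℕ} (hn : n ≤ k) :
    Sect2.omegaPlaqsTop (truncSeq s).Ω Ω₀ n = Sect2.omegaPlaqsTop s.Ω Ω₀ n := by
  unfold Sect2.omegaPlaqsTop
  rw [truncSeq_Ω_of_le s hn]

/-- **THE BOND RANGES COINCIDE AT AND BELOW `k`** (same top domain). [cite: Balaban1985RegularSpaces, (1.9) p.77; Balaban1985Variational, (2) p.278, (13) p.280] -/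
theorem omegaBondsTop_truncSeq_of_le (s : Seq D (k + 1)) (Ω₀ : Set (Site P 0)) {n : ℕ} (hn : n ≤ k) :
    Sect2.omegaBondsTop (truncSeq s).Ω Ω₀ n = Sect2.omegaBondsTop s.Ω Ω₀ n := by
  unfold Sect2.omegaBondsTop
  rw [truncSeq_Ω_of_le s hn]

/-- **THE NEW TOP PLAQUETTE RANGE SITS INSIDE THE SCALE-`k` RANGE** (`0 < k`): the plaquettes meeting `Ω_{k+1} ⊆ Ω_k` ([III] (2.1) nesting) — where (13)'s factor `L²`∕`L³` is paid
(`η_k = L·η_{k+1}`). [cite: Balaban1985RegularSpaces, (1.7) p.77; Balaban1988Convergent, (2.1) p.254; Balaban1985Variational, (13) p.280] -/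
theorem omegaPlaqsTop_succ_subset (s : Seq D (k + 1)) (hk : 0 < k) (Ω₀ : Set (Site P 0)) :
    Sect2.omegaPlaqsTop s.Ω Ω₀ (k + 1) ⊆ Sect2.omegaPlaqsTop s.Ω Ω₀ k := by
  unfold Sect2.omegaPlaqsTop
  rw [if_neg (Nat.succ_ne_zero k), if_neg (Nat.pos_iff_ne_zero.mp hk)]
  exact B8Eq17ClassAkV1.plaqsOf_mono (s.chain.Ω_succ_subset_Ω hk (lt_add_one k))

/-- **THE NEW TOP BOND RANGE SITS INSIDE THE SCALE-`k` RANGE** (`0 < k`). [cite: Balaban1985RegularSpaces, (1.9) p.77; Balaban1988Convergent, (2.1) p.254; Balaban1985Variational, (13) p.280] -/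
theorem omegaBondsTop_succ_subset (s : Seq D (k + 1)) (hk : 0 < k) (Ω₀ : Set (Site P 0)) :
    Sect2.omegaBondsTop s.Ω Ω₀ (k + 1) ⊆ Sect2.omegaBondsTop s.Ω Ω₀ k := by
  unfold Sect2.omegaBondsTop
  rw [if_neg (Nat.succ_ne_zero k), if_neg (Nat.pos_iff_ne_zero.mp hk)]
  exact bondsOf_mono' (s.chain.Ω_succ_subset_Ω hk (lt_add_one k))

/-- With the SAME top domain the truncated top range at `k` also contains the full problem's new top range (the form the lift token's hypothesis arrives in).
[cite: Balaban1985RegularSpaces, (1.7) p.77; Balaban1985Variational, (13) p.280] -/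
theorem omegaPlaqsTop_succ_subset_truncSeq (s : Seq D (k + 1)) (hk : 0 < k) (Ω₀ : Set (Site P 0)) :
    Sect2.omegaPlaqsTop s.Ω Ω₀ (k + 1) ⊆ Sect2.omegaPlaqsTop (truncSeq s).Ω Ω₀ k := by
  rw [omegaPlaqsTop_truncSeq_of_le s Ω₀ le_rfl]
  exact omegaPlaqsTop_succ_subset s hk Ω₀

/-- Bond edition of the previous lemma. [cite: Balaban1985RegularSpaces, (1.9) p.77; Balaban1985Variational, (13) p.280] -/
theorem omegaBondsTop_succ_subset_truncSeq (s : Seq D (k + 1)) (hk : 0 < k) (Ω₀ : Set (Site P 0)) :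
    Sect2.omegaBondsTop s.Ω Ω₀ (k + 1) ⊆ Sect2.omegaBondsTop (truncSeq s).Ω Ω₀ k := by
  rw [omegaBondsTop_truncSeq_of_le s Ω₀ le_rfl]
  exact omegaBondsTop_succ_subset s hk Ω₀

end Ranges

section Selector

variable {F : T4Family} {ν : Stage7Numerics} {M : ℕ} {g : ℕ → ℝ} {K k : ℕ}

/-- **node00-def-R's SELECTOR IS TRUNCATION-INVARIANT** (`0 < k`): `suppDomOfRecord F ν K Ω` reads `Ω_1` only (`suppDomOfRecord_congr`), which the truncation keeps.
[cite: Balaban1988Convergent, p.255, (2.18) p.257; Balaban1985Variational, (11) p.279 (bookkeeping)] -/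
theorem suppDomOfRecord_truncSeq (s : SeqOfRecord F ν M g K (k + 1)) (hk : 0 < k) :
    suppDomOfRecord F ν K (truncSeq s).Ω = suppDomOfRecord F ν K s.Ω :=
  suppDomOfRecord_congr (F := F) ν K (truncSeq_Ω_of_le s hk)

end Selector

end Literature.MathematicalPhysics.QuantumFieldTheory.Balaban1983to89.B11Thm1ExistsUniqueInductionG

end
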